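import Summits.MatrixMultiplication.MatrixMultiplication.Theorems.SoloInformedTwistedMatchingsEffective
import HarnessLib

/-!
# Effective Theorem B″: explicit exponents for hosts of exponent `2` and `3`

Solo-informed seat (MatrixMultiplication), gen 101; sharpest-statement §2y(7)(B)/(8), effective form.
Specialising `twistedMatching_card_le_effective` at `u = 1/2` (`p = 2`) and `u = 3/5` (`p = 3`):
every twisted matching (any finite family of automorphism-pair twists) in a finite abelian group `S`
* of exponent `2` has `|ι| ≤ 3 |S|^{23/25}` (`θ_2(1/2) = 2^{1/3}·3/2 = 1.88988 = 2^{0.91830} ≤ 2^{0.92}`,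
  the optimal slice-rank exponent being `0.91830`);
* of exponent `3` has `|ι| ≤ 3 |S|^{14/15}` (`θ_3(3/5) = (5/3)^{2/3}·49/25 = 2.75522 = 3^{0.92254}
  ≤ 3^{0.9334}`; the Ellenberg–Gijswijt cap-set exponent is `0.92254`).
The rational exponents `23/25`, `14/15` are chosen so that the comparison is a `norm_num` fact
(`3^75 ≤ 2^119`, `(5/3)^10 (49/25)^15 ≤ 3^14`).
References: EllenbergGijswijt2017; BCCGNSU17 (arXiv:1605.06702) Thm 4.14 / eq. (4.11).
-/

noncomputable section

open scoped BigOperators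
open Finset

namespace Summit.MatrixMultiplication.MatrixMultiplication.Theorems.TwistedSliceRank

section EffectiveConstants

/-- From `θ ≤ p^c` to `3 θ^k ≤ 3 (p^k)^c`. [folklore] -/
theorem three_mul_pow_le_rpow (p : ℕ) (hp : 0 < p) (θ c : ℝ) (hθ : 0 ≤ θ)
    (hle : θ ≤ (p : ℝ) ^ c) (k : ℕ) :
    3 * θ ^ k ≤ 3 * ((p ^ k : ℕ) : ℝ) ^ c := by
  have hp0 : (0 : ℝ) ≤ p := Nat.cast_nonneg p
  have h1 : θ ^ k ≤ ((p : ℝ) ^ c) ^ k := pow_le_pow_left₀ hθ hle k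
  have h2 : ((p : ℝ) ^ c) ^ k = ((p ^ k : ℕ) : ℝ) ^ c := by
    push_cast
    rw [← Real.rpow_natCast, ← Real.rpow_mul hp0, mul_comm, Real.rpow_mul hp0, Real.rpow_natCast]
  rw [h2] at h1
  have := hp
  linarith

/-- **Exponent-`2` hosts: `|ι| ≤ 3 |S|^{0.92}`** for every twisted matching under any finite family of
automorphism-pair twists. [this work] -/
theorem twistedMatching_card_le_exp_two (S : Type) [CommGroup S] [Fintype S] [DecidableEq S]
    (hexpS : ∀ g : S, g ^ 2 = 1) (σ : Type) [Fintype σ] (φ ψ : σ → S ≃* S) (ι : Type)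
    [Fintype ι] (x y z : ι → S)
    (hmatch : ∀ i j l : ι, (∃ s : σ, x i * φ s (y j) * ψ s (z l) = 1) ↔ (i = j ∧ j = l)) :
    (Fintype.card ι : ℝ) ≤ 3 * (Fintype.card S : ℝ) ^ (23 / 25 : ℝ) := by
  haveI : Fact (Nat.Prime 2) := ⟨Nat.prime_two⟩
  obtain ⟨k, hk⟩ := (IsPGroup.iff_card (p := 2) (G := S)).1
    (fun g => ⟨1, by rw [pow_one]; exact hexpS g⟩)
  rw [Nat.card_eq_fintype_card] at hk
  have h := twistedMatching_card_le_effective 2 S hexpS k hk σ φ ψ ι x y z hmatch (1 / 2)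
    (by norm_num) (by norm_num)
  have hθ : ((1 / 2 : ℝ) ^ (-(((2 - 1 : ℕ) : ℝ) / 3)) * ∑ j : Fin 2, (1 / 2 : ℝ) ^ ((j : ℕ) : ℝ))
      = (2 : ℝ) ^ ((1 : ℝ) / 3) * (3 / 2) := by
    rw [Fin.sum_univ_two, Fin.val_zero, Fin.val_one, Nat.cast_zero, Nat.cast_one, Real.rpow_zero,
      Real.rpow_one, one_div (2 : ℝ), Real.rpow_neg (by norm_num), Real.inv_rpow (by norm_num),
      inv_inv]
    norm_num
  rw [hθ] at h
  have hθle : (2 : ℝ) ^ ((1 : ℝ) / 3) * (3 / 2) ≤ (2 : ℝ) ^ ((23 : ℝ) / 25) := by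
    have h75 : ((2 : ℝ) ^ ((1 : ℝ) / 3) * (3 / 2)) ^ (75 : ℕ) ≤ ((2 : ℝ) ^ ((23 : ℝ) / 25)) ^ (75 : ℕ) := by
      rw [mul_pow, ← Real.rpow_natCast ((2 : ℝ) ^ ((1 : ℝ) / 3)) 75,
        ← Real.rpow_mul (by norm_num), ← Real.rpow_natCast ((2 : ℝ) ^ ((23 : ℝ) / 25)) 75,
        ← Real.rpow_mul (by norm_num),
        show ((1 : ℝ) / 3 * ((75 : ℕ) : ℝ)) = ((25 : ℕ) : ℝ) by norm_num,
        show ((23 : ℝ) / 25 * ((75 : ℕ) : ℝ)) = ((69 : ℕ) : ℝ) by norm_num,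
        Real.rpow_natCast, Real.rpow_natCast]
      norm_num
    exact le_of_pow_le_pow_left₀ (by norm_num) (by positivity) h75
  rw [hk]
  exact h.trans (three_mul_pow_le_rpow 2 (by norm_num) _ _ (by positivity) hθle k)

/-- **Exponent-`3` hosts: `|ι| ≤ 3 |S|^{14/15}`** for every twisted matching under any finite family of
automorphism-pair twists (the cap-set exponent `0.92254` rounded up to `0.9334`). [this work] -/
theorem twistedMatching_card_le_exp_three (S : Type) [CommGroup S] [Fintype S] [DecidableEq S]
    (hexpS : ∀ g : S, g ^ 3 = 1) (σ : Type) [Fintype σ] (φ ψ : σ → S ≃* S) (ι : Type)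
    [Fintype ι] (x y z : ι → S)
    (hmatch : ∀ i j l : ι, (∃ s : σ, x i * φ s (y j) * ψ s (z l) = 1) ↔ (i = j ∧ j = l)) :
    (Fintype.card ι : ℝ) ≤ 3 * (Fintype.card S : ℝ) ^ (14 / 15 : ℝ) := by
  haveI : Fact (Nat.Prime 3) := ⟨Nat.prime_three⟩
  obtain ⟨k, hk⟩ := (IsPGroup.iff_card (p := 3) (G := S)).1
    (fun g => ⟨1, by rw [pow_one]; exact hexpS g⟩)
  rw [Nat.card_eq_fintype_card] at hk
  have h := twistedMatching_card_le_effective 3 S hexpS k hk σ φ ψ ι x y z hmatch (3 / 5)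
    (by norm_num) (by norm_num)
  have hθ : ((3 / 5 : ℝ) ^ (-(((3 - 1 : ℕ) : ℝ) / 3)) * ∑ j : Fin 3, (3 / 5 : ℝ) ^ ((j : ℕ) : ℝ))
      = ((5 : ℝ) / 3) ^ ((2 : ℝ) / 3) * (49 / 25) := by
    rw [Fin.sum_univ_three, Fin.val_zero, Fin.val_one, Fin.val_two, Nat.cast_zero, Nat.cast_one,
      Nat.cast_two, Real.rpow_zero, Real.rpow_one, Real.rpow_two,
      show ((3 : ℝ) / 5) = ((5 : ℝ) / 3)⁻¹ by norm_num, Real.rpow_neg (by norm_num),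
      Real.inv_rpow (by norm_num), inv_inv]
    norm_num
  rw [hθ] at h
  have hθle : ((5 : ℝ) / 3) ^ ((2 : ℝ) / 3) * (49 / 25) ≤ (3 : ℝ) ^ ((14 : ℝ) / 15) := by
    have h15 : (((5 : ℝ) / 3) ^ ((2 : ℝ) / 3) * (49 / 25)) ^ (15 : ℕ) ≤
        ((3 : ℝ) ^ ((14 : ℝ) / 15)) ^ (15 : ℕ) := by
      rw [mul_pow, ← Real.rpow_natCast (((5 : ℝ) / 3) ^ ((2 : ℝ) / 3)) 15,
        ← Real.rpow_mul (by norm_num), ← Real.rpow_natCast ((3 : ℝ) ^ ((14 : ℝ) / 15)) 15,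
        ← Real.rpow_mul (by norm_num),
        show ((2 : ℝ) / 3 * ((15 : ℕ) : ℝ)) = ((10 : ℕ) : ℝ) by norm_num,
        show ((14 : ℝ) / 15 * ((15 : ℕ) : ℝ)) = ((14 : ℕ) : ℝ) by norm_num,
        Real.rpow_natCast, Real.rpow_natCast]
      norm_num
    exact le_of_pow_le_pow_left₀ (by norm_num) (by positivity) h15
  rw [hk]
  exact h.trans (three_mul_pow_le_rpow 3 (by norm_num) _ _ (by positivity) hθle k)

end EffectiveConstants

end Summit.MatrixMultiplication.MatrixMultiplication.Theorems.TwistedSliceRank
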